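import Summits.MatrixMultiplication.OmegaCensus.DominoZ5Z65Cell19Core
import Summits.MatrixMultiplication.OmegaCensus.DominoZ5Z5Fin19S0
import Summits.MatrixMultiplication.OmegaCensus.DominoZ5Z5Fin19S5
import Summits.MatrixMultiplication.OmegaCensus.ThreeSetZ5Z65Cells3xTPP
import HarnessLib

/-!
# The census cell `(1,9,12)@325` of `ℤ₅ × ℤ₆₅`: no domino cube law triple with parts `1` and `9` — ORDER 325 FULLY KERNEL

ω-census `pub-omega`, family (b3), seat pub-omega-group gen 37 (staged), landed by gen 38 after `DominoZ5Z5Fin19S0/S5`.  Framing: lottery ticket;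
floor = certified bounds/negative ranges.  VALUE: the last engine-only cell of order `325` (NR79, ENGINE ×3) becomes KERNEL: with
`no_law_cube_three_three/four/six_z5_z65` and the domino cells `(1,3,36)`, `(1,4,27)`, `(1,6,18)` every cell of `ℤ₅ × ℤ₆₅` is a kernel
theorem.  NOT progress on ω.
* `no_cube_form_19_of_card325` — `no_cube_form_19_of_fin` with `fin19s0`, `fin19s5`;
* `no_law_cube_19e_of_card325`, `no_law_cube_one_nine_of_card325` (all orderings), instance **`no_law_cube_one_nine_z5_z65`**.
-/

namespace Summit.MatrixMultiplication.OmegaCensus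

open Finset ZpZpDomino Z5Z5ThreeSet Literature.Combinatorics.Additive

section Core

variable {A : Type*} [AddCommGroup A] [Fintype A] [DecidableEq A]

/-- **No domino cube symmetric form with `|W| = 1`, `|X| = 9`** over `A` of order `325` with `Φ : A ↠ ℤ₅²` and a non-zero `Ψ : A →+ ZMod 13`
whose `Φ`-fibre sums vanish. [folklore] -/
theorem no_cube_form_19_of_card325 (hA : Fintype.card A = 325) (Φ : A →+ ZMod 5 × ZMod 5) (hΦ : Function.Surjective Φ)
    (Ψ : A →+ ZMod 13) (hΨ : Ψ ≠ 0) (hΨΦ : ∀ t : ZMod 5 × ZMod 5, ∑ a ∈ univ.filter (fun a : A => Φ a = t), Ψ a = 0)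
    {W X Y : Finset A} {x₀ : A} (hW : W.card = 1) (hX : X.card = 9)
    (h₁ : Set.InjOn (fun p : A × A × A => -p.1 + p.2.1 + p.2.2) ↑(W ×ˢ X ×ˢ Y))
    (h₂ : Set.InjOn (fun p : A × A × A => p.1 - p.2.1 + p.2.2) ↑(W ×ˢ X ×ˢ Y))
    (h₃ : Set.InjOn (fun p : A × A × A => p.1 + p.2.1 - p.2.2) ↑(W ×ˢ X ×ˢ Y))
    (d₁₂ : Disjoint ((W ×ˢ X ×ˢ Y).image fun p : A × A × A => -p.1 + p.2.1 + p.2.2)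
      ((W ×ˢ X ×ˢ Y).image fun p : A × A × A => p.1 - p.2.1 + p.2.2))
    (d₁₃ : Disjoint ((W ×ˢ X ×ˢ Y).image fun p : A × A × A => -p.1 + p.2.1 + p.2.2)
      ((W ×ˢ X ×ˢ Y).image fun p : A × A × A => p.1 + p.2.1 - p.2.2))
    (d₂₃ : Disjoint ((W ×ˢ X ×ˢ Y).image fun p : A × A × A => p.1 - p.2.1 + p.2.2)
      ((W ×ˢ X ×ˢ Y).image fun p : A × A × A => p.1 + p.2.1 - p.2.2))
    (hcover : ((W ×ˢ X ×ˢ Y).image fun p : A × A × A => -p.1 + p.2.1 + p.2.2) ∪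
      ((W ×ˢ X ×ˢ Y).image fun p : A × A × A => p.1 - p.2.1 + p.2.2) ∪
      ((W ×ˢ X ×ˢ Y).image fun p : A × A × A => p.1 + p.2.1 - p.2.2) = univ.erase x₀) : False :=
  no_cube_form_19_of_fin fin19s0 fin19s5 hA Φ hΦ Ψ hΨ hΨΦ hW hX h₁ h₂ h₃ d₁₂ d₁₃ d₂₃ hcover

end Core

section DihedralLike

variable {A : Type} [AddCommGroup A] [DecidableEq A] [Fintype A] {G : Type} [Group G] [DecidableEq G]
  {ρ τ : A → G} {c₀ : A} {S T U : Finset G}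

/-- **No `(1,1 | 9,9 | e,e)` law triple** over `A` of order `325` (every element a double) with `Φ : A ↠ ℤ₅²` and a non-zero `Ψ : A →+ ZMod 13`
whose `Φ`-fibre sums vanish; dihedral-like `G`, any `c₀`. [folklore] -/
theorem no_law_cube_19e_of_card325 (hA : Fintype.card A = 325)
    (hρρ : ∀ a b, ρ a * ρ b = ρ (a + b)) (hρτ : ∀ a b, ρ a * τ b = τ (b - a))
    (hτρ : ∀ a b, τ a * ρ b = τ (a + b)) (hττ : ∀ a b, τ a * τ b = ρ (c₀ + b - a))
    (hρ : Function.Injective ρ) (hτ : Function.Injective τ) (hne : ∀ a b, ρ a ≠ τ b)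
    (hsurj : ∀ g, (∃ a, ρ a = g) ∨ (∃ a, τ a = g)) (hhalf : ∀ c : A, ∃ a : A, a + a = c)
    (Φ : A →+ ZMod 5 × ZMod 5) (hΦ : Function.Surjective Φ)
    (Ψ : A →+ ZMod 13) (hΨ : Ψ ≠ 0) (hΨΦ : ∀ t : ZMod 5 × ZMod 5, ∑ a ∈ univ.filter (fun a : A => Φ a = t), Ψ a = 0)
    (h : TripleProductProperty S T U)
    (hS₀ : (univ.filter fun a : A => ρ a ∈ S).card = 1) (hS₁ : (univ.filter fun a : A => τ a ∈ S).card = 1)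
    (hT₀ : (univ.filter fun a : A => ρ a ∈ T).card = 9) (hT₁ : (univ.filter fun a : A => τ a ∈ T).card = 9)
    (hU : (univ.filter fun a : A => ρ a ∈ U).card = (univ.filter fun a : A => τ a ∈ U).card)
    (hV : 3 * (S.card * T.card * U.card) + 8 = 8 * Fintype.card A) : False := by
  classical
  obtain ⟨W, X, Y, x₀, hWc, hXc, -, i₁, i₂, i₃, d₁₂, d₁₃, d₂₃, hcover⟩ :=
    cube_symmetric_form_of_law hρρ hρτ hτρ hττ hρ hτ hne hsurj hhalf h (by rw [hS₀, hS₁]) (by rw [hT₀, hT₁]) hU hV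
  rw [hS₀] at hWc
  rw [hT₀] at hXc
  exact no_cube_form_19_of_card325 hA Φ hΦ Ψ hΨ hΨΦ hWc hXc i₁ i₂ i₃ d₁₂ d₁₃ d₂₃ hcover

/-- **Cell form `(1,9,·)@325`**: balanced coset parts, a part `1` and another part `9` (any positions) ⇒ `3|S||T||U| + 8 ≠ 8|A|`. [folklore] -/
theorem no_law_cube_one_nine_of_card325 (hA : Fintype.card A = 325)
    (hρρ : ∀ a b, ρ a * ρ b = ρ (a + b)) (hρτ : ∀ a b, ρ a * τ b = τ (b - a))
    (hτρ : ∀ a b, τ a * ρ b = τ (a + b)) (hττ : ∀ a b, τ a * τ b = ρ (c₀ + b - a))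
    (hρ : Function.Injective ρ) (hτ : Function.Injective τ) (hne : ∀ a b, ρ a ≠ τ b)
    (hsurj : ∀ g, (∃ a, ρ a = g) ∨ (∃ a, τ a = g)) (hhalf : ∀ c : A, ∃ a : A, a + a = c)
    (Φ : A →+ ZMod 5 × ZMod 5) (hΦ : Function.Surjective Φ)
    (Ψ : A →+ ZMod 13) (hΨ : Ψ ≠ 0) (hΨΦ : ∀ t : ZMod 5 × ZMod 5, ∑ a ∈ univ.filter (fun a : A => Φ a = t), Ψ a = 0)
    (h : TripleProductProperty S T U)
    (hS : (univ.filter fun a : A => ρ a ∈ S).card = (univ.filter fun a : A => τ a ∈ S).card)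
    (hT : (univ.filter fun a : A => ρ a ∈ T).card = (univ.filter fun a : A => τ a ∈ T).card)
    (hU : (univ.filter fun a : A => ρ a ∈ U).card = (univ.filter fun a : A => τ a ∈ U).card)
    (h19 : ((univ.filter fun a : A => ρ a ∈ S).card = 1 ∧ (univ.filter fun a : A => ρ a ∈ T).card = 9) ∨
      ((univ.filter fun a : A => ρ a ∈ T).card = 1 ∧ (univ.filter fun a : A => ρ a ∈ U).card = 9) ∨
      ((univ.filter fun a : A => ρ a ∈ U).card = 1 ∧ (univ.filter fun a : A => ρ a ∈ S).card = 9) ∨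
      ((univ.filter fun a : A => ρ a ∈ S).card = 9 ∧ (univ.filter fun a : A => ρ a ∈ T).card = 1) ∨
      ((univ.filter fun a : A => ρ a ∈ T).card = 9 ∧ (univ.filter fun a : A => ρ a ∈ U).card = 1) ∨
      ((univ.filter fun a : A => ρ a ∈ U).card = 9 ∧ (univ.filter fun a : A => ρ a ∈ S).card = 1)) :
    3 * (S.card * T.card * U.card) + 8 ≠ 8 * Fintype.card A :=
  no_law_cube_two_parts_of_ordered 1 9
    (fun h' hS₀ hS₁ hT₀ hT₁ hU' hV => no_law_cube_19e_of_card325 hA hρρ hρτ hτρ hττ hρ hτ hne hsurj hhalf Φ hΦ Ψ hΨ hΨΦ h'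
      hS₀ hS₁ hT₀ hT₁ hU' hV) h hS hT hU h19

/-- **Census instance `(1,9,12)@325`**: for every dihedral-like group over `A = ℤ₅ × ℤ₆₅` (order `325`, any `c₀`) no TPP triple with
balanced coset parts having a part `1` and another part `9` attains `3|S||T||U| + 8 = 8|A|`. [folklore] -/
theorem no_law_cube_one_nine_z5_z65 {ρ τ : ZMod 5 × ZMod 65 → G} {c₀ : ZMod 5 × ZMod 65}
    (hρρ : ∀ a b, ρ a * ρ b = ρ (a + b)) (hρτ : ∀ a b, ρ a * τ b = τ (b - a))
    (hτρ : ∀ a b, τ a * ρ b = τ (a + b)) (hττ : ∀ a b, τ a * τ b = ρ (c₀ + b - a))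
    (hρ : Function.Injective ρ) (hτ : Function.Injective τ) (hne : ∀ a b, ρ a ≠ τ b)
    (hsurj : ∀ g, (∃ a, ρ a = g) ∨ (∃ a, τ a = g))
    (h : TripleProductProperty S T U)
    (hS : (univ.filter fun a => ρ a ∈ S).card = (univ.filter fun a => τ a ∈ S).card)
    (hT : (univ.filter fun a => ρ a ∈ T).card = (univ.filter fun a => τ a ∈ T).card)
    (hU : (univ.filter fun a => ρ a ∈ U).card = (univ.filter fun a => τ a ∈ U).card)
    (h19 : ((univ.filter fun a => ρ a ∈ S).card = 1 ∧ (univ.filter fun a => ρ a ∈ T).card = 9) ∨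
      ((univ.filter fun a => ρ a ∈ T).card = 1 ∧ (univ.filter fun a => ρ a ∈ U).card = 9) ∨
      ((univ.filter fun a => ρ a ∈ U).card = 1 ∧ (univ.filter fun a => ρ a ∈ S).card = 9) ∨
      ((univ.filter fun a => ρ a ∈ S).card = 9 ∧ (univ.filter fun a => ρ a ∈ T).card = 1) ∨
      ((univ.filter fun a => ρ a ∈ T).card = 9 ∧ (univ.filter fun a => ρ a ∈ U).card = 1) ∨
      ((univ.filter fun a => ρ a ∈ U).card = 9 ∧ (univ.filter fun a => ρ a ∈ S).card = 1)) :
    3 * (S.card * T.card * U.card) + 8 ≠ 8 * Fintype.card (ZMod 5 × ZMod 65) :=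
  no_law_cube_one_nine_of_card325 (by rw [Fintype.card_prod, ZMod.card, ZMod.card]) hρρ hρτ hτρ hττ hρ hτ hne hsurj
    (exists_add_self_eq_of_card_odd (by rw [Fintype.card_prod, ZMod.card, ZMod.card]; decide))
    projZ5Z65 projZ5Z65_surjective projZ13 projZ13_ne_zero projZ13_fibre_sum h hS hT hU h19

end DihedralLike

end Summit.MatrixMultiplication.OmegaCensus
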